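import Summits.AtomisticToContinuum.Crystallization.Theorems.PricedLinkCensusStackingHingeExactWindowOfAllScales

/-!
# Route `PricedLinkCensus`, crux `StackingHinge` (stmt-AtomisticToContinuum-14993), line `Sketch`:
# stub `stub_similarStarNormalisation` (V3), support file II — similar stars matched at every
# tolerance are matched exactly

Compactness of `O(E) × [t-range]` for a finite-dimensional real normed space `E`:

* `exact_of_matched` — if a finite nonempty set `R` (norms in `[m, M]`, `m > 0`) is, for every
  `n`, two-way `t_n/(n+1)`-matched to a SIMILAR copy `t_n • A_n '' F` of a finite set `F` (norms in
  `[c, C]`, `c > 1/2`), then `R = t • A '' F` EXACTLY for some linear isometry equivalence `A` and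
  some `t > 0`: the dilations are pinned in `[m/(C+1), M/(c − 1/2)]` (Bolzano–Weierstrass), the
  rotations have a convergent subsequence (`exists_subseq_tendsto_linearIsometryEquiv`, landed with
  `stub_exactWindowOfAllScales`), and matched partners range over finite sets while the tolerance
  tends to `0`;
* `exact_of_matched_two` — the same when the reference set may be either of two finite sets
  `F₁, F₂` depending on `n` (one of them serves infinitely often).

All `[folklore]`.
-/

noncomputable section

namespace Summit.AtomisticToContinuum.Crystallization.Theorems.PricedHcpWindowsSimilarStarNormalisation

open Filter Topology Metric Set
open Summit.AtomisticToContinuum.Crystallization.Theorems.PricedHcpWindowsExactWindow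
  (exists_subseq_tendsto_linearIsometryEquiv)

variable {E : Type*} [NormedAddCommGroup E] [NormedSpace ℝ E] [FiniteDimensional ℝ E]

/-- **Limit step over finitely many candidates**: if `D k q → ℓ q > 0` for each `q` in a finite set
`Q` and `ε_k → 0`, then for some `k` all `D k q` exceed `ε_k`. [folklore] -/
theorem exists_forall_lt_of_finite {α : Type*} {Q : Set α} (hQ : Q.Finite) {D : ℕ → α → ℝ}
    {ℓ : α → ℝ}
    (hD : ∀ q ∈ Q, Tendsto (fun k => D k q) atTop (𝓝 (ℓ q))) (hℓ : ∀ q ∈ Q, 0 < ℓ q)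
    {ε : ℕ → ℝ} (hε : Tendsto ε atTop (𝓝 0)) : ∃ k : ℕ, ∀ q ∈ Q, ε k < D k q := by
  have hev : ∀ᶠ k in atTop, ∀ q ∈ Q, ε k < D k q :=
    (eventually_all_finite hQ).2 fun q hq => hε.eventually_lt (hD q hq) (hℓ q hq)
  exact hev.exists

/-- **Similar copies matching a finite set at every tolerance match it exactly.**  Let `R` be finite
and nonempty with norms in `[m, M]`, `m > 0`, and `F` finite with norms in `[c, C]`, `c > 1/2`.
If for every `n` some similar copy `t • A '' F` (`A` a linear isometry equivalence, `t > 0`) is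
two-way `t/(n+1)`-matched with `R`, then `R = t • A '' F` exactly for some such `A, t`.
[folklore] -/
theorem exact_of_matched {R F : Set E} (hR : R.Finite) (hF : F.Finite) (hRne : R.Nonempty)
    {m M c C : ℝ} (hm : 0 < m) (hc : 1 / 2 < c) (hC : 0 ≤ C)
    (hRn : ∀ y ∈ R, m ≤ ‖y‖ ∧ ‖y‖ ≤ M) (hFn : ∀ v ∈ F, c ≤ ‖v‖ ∧ ‖v‖ ≤ C)
    (hmatch : ∀ n : ℕ, ∃ A : E ≃ₗᵢ[ℝ] E, ∃ t : ℝ, 0 < t ∧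
      (∀ y ∈ R, ∃ v ∈ F, dist y (t • A v) ≤ 1 / ((n : ℝ) + 1) * t) ∧
      (∀ v ∈ F, ∃ y ∈ R, dist y (t • A v) ≤ 1 / ((n : ℝ) + 1) * t)) :
    ∃ A : E ≃ₗᵢ[ℝ] E, ∃ t : ℝ, 0 < t ∧ R = (fun v => t • A v) '' F := by
  choose A t ht hA₁ hA₂ using hmatch
  obtain ⟨y₀, hy₀⟩ := hRne
  obtain ⟨v₀, hv₀, -⟩ := hA₁ 0 y₀ hy₀
  have hM : 0 < M := hm.trans_le ((hRn y₀ hy₀).1.trans (hRn y₀ hy₀).2)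
  -- norms of the similar copies
  have hnorm : ∀ n v, ‖t n • A n v‖ = t n * ‖v‖ := fun n v => by
    rw [norm_smul, Real.norm_of_nonneg (ht n).le, LinearIsometryEquiv.norm_map]
  -- tolerances at index `n + 1` are at most `t / 2`
  have htol : ∀ n : ℕ, 1 / (((n + 1 : ℕ) : ℝ) + 1) * t (n + 1) ≤ t (n + 1) / 2 := fun n => by
    have h1 : 1 / (((n + 1 : ℕ) : ℝ) + 1) ≤ 1 / 2 :=
      one_div_le_one_div_of_le (by norm_num) (by push_cast; linarith [(n.cast_nonneg : (0 : ℝ) ≤ n)])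
    have := mul_le_mul_of_nonneg_right h1 (ht (n + 1)).le
    linarith
  -- the dilations are pinned
  have htb : ∀ n : ℕ, t (n + 1) ∈ Icc (m / (C + 1)) (M / (c - 1 / 2)) := by
    intro n
    constructor
    · obtain ⟨y, hy, hd⟩ := hA₂ (n + 1) v₀ hv₀
      have h1 : ‖y‖ ≤ ‖t (n + 1) • A (n + 1) v₀‖ + dist y (t (n + 1) • A (n + 1) v₀) := by
        have := norm_sub_norm_le y (t (n + 1) • A (n + 1) v₀)
        rw [← dist_eq_norm] at this
        linarith
      rw [hnorm] at h1
      have h2 := (hRn y hy).1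
      have h3 := mul_le_mul_of_nonneg_left (hFn v₀ hv₀).2 (ht (n + 1)).le
      have h4 := htol n
      rw [div_le_iff₀ (by linarith)]
      nlinarith [ht (n + 1)]
    · obtain ⟨v, hv, hd⟩ := hA₁ (n + 1) y₀ hy₀
      have h1 : ‖t (n + 1) • A (n + 1) v‖ ≤ ‖y₀‖ + dist y₀ (t (n + 1) • A (n + 1) v) := by
        have := norm_sub_norm_le (t (n + 1) • A (n + 1) v) y₀
        rw [← dist_eq_norm, dist_comm] at this
        linarith
      rw [hnorm] at h1
      have h2 := (hRn y₀ hy₀).2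
      have h3 := mul_le_mul_of_nonneg_left (hFn v hv).1 (ht (n + 1)).le
      have h4 := htol n
      rw [le_div_iff₀ (by linarith)]
      nlinarith
  -- subsequences: dilations converge, then rotations converge
  obtain ⟨t₀, ht₀mem, φ₁, hφ₁, hlim₁⟩ := tendsto_subseq_of_bounded (isBounded_Icc _ _) htb
  rw [closure_Icc] at ht₀mem
  obtain ⟨B, φ₂, hφ₂, hlim₂⟩ := exists_subseq_tendsto_linearIsometryEquiv fun k => A (φ₁ k + 1)
  set ψ : ℕ → ℕ := fun k => φ₁ (φ₂ k) + 1 with hψ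
  have hψt : Tendsto (fun k => t (ψ k)) atTop (𝓝 t₀) := hlim₁.comp hφ₂.tendsto_atTop
  have hψA : ∀ x, Tendsto (fun k => A (ψ k) x) atTop (𝓝 (B x)) := hlim₂
  have hψtop : Tendsto ψ atTop atTop :=
    (tendsto_add_atTop_nat 1).comp ((hφ₁.comp hφ₂).tendsto_atTop)
  have hε : Tendsto (fun k => 1 / ((ψ k : ℝ) + 1) * t (ψ k)) atTop (𝓝 0) := by
    have h0 : Tendsto (fun k => 1 / ((ψ k : ℝ) + 1)) atTop (𝓝 0) :=
      tendsto_one_div_add_atTop_nhds_zero_nat.comp hψtop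
    simpa using h0.mul hψt
  have ht₀ : 0 < t₀ := lt_of_lt_of_le (div_pos hm (by linarith)) ht₀mem.1
  have hconv : ∀ v, Tendsto (fun k => t (ψ k) • A (ψ k) v) atTop (𝓝 (t₀ • B v)) :=
    fun v => hψt.smul (hψA v)
  refine ⟨B, t₀, ht₀, Set.ext fun y => ⟨fun hy => ?_, ?_⟩⟩
  · -- a point of `R` is the image of some `v ∈ F`
    by_contra hne
    have hne' : ∀ v ∈ F, 0 < dist y (t₀ • B v) := fun v hv =>
      dist_pos.2 fun h => hne ⟨v, hv, h.symm⟩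
    obtain ⟨k, hk⟩ := exists_forall_lt_of_finite hF (D := fun k v => dist y (t (ψ k) • A (ψ k) v))
      (fun v _ => tendsto_const_nhds.dist (hconv v)) hne' hε
    obtain ⟨v, hv, hd⟩ := hA₁ (ψ k) y hy
    exact absurd hd (not_le.2 (hk v hv))
  · -- the image of `v ∈ F` is a point of `R`
    rintro ⟨v, hv, rfl⟩
    show t₀ • B v ∈ R
    by_contra hBv
    have hne' : ∀ q ∈ R, 0 < dist q (t₀ • B v) := fun q hq =>
      dist_pos.2 fun h => hBv (h ▸ hq)
    obtain ⟨k, hk⟩ := exists_forall_lt_of_finite hR (D := fun k q => dist q (t (ψ k) • A (ψ k) v))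
      (fun q _ => tendsto_const_nhds.dist (hconv v)) hne' hε
    obtain ⟨q, hq, hd⟩ := hA₂ (ψ k) v hv
    exact absurd hd (not_le.2 (hk q hq))

/-- **Two candidate reference sets.**  As `exact_of_matched`, when at each `n` the reference set is
one of two finite sets `F₁, F₂` (norms in `[c, C]`, `c > 1/2`): one of them serves for infinitely
many `n`, hence (tolerances decrease) for all `n`. [folklore] -/
theorem exact_of_matched_two {R F₁ F₂ : Set E} (hR : R.Finite) (hF₁ : F₁.Finite)
    (hF₂ : F₂.Finite) (hRne : R.Nonempty) {m M c C : ℝ} (hm : 0 < m) (hc : 1 / 2 < c) (hC : 0 ≤ C)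
    (hRn : ∀ y ∈ R, m ≤ ‖y‖ ∧ ‖y‖ ≤ M) (hFn₁ : ∀ v ∈ F₁, c ≤ ‖v‖ ∧ ‖v‖ ≤ C)
    (hFn₂ : ∀ v ∈ F₂, c ≤ ‖v‖ ∧ ‖v‖ ≤ C)
    (hmatch : ∀ n : ℕ, ∃ A : E ≃ₗᵢ[ℝ] E, ∃ t : ℝ, 0 < t ∧ ∃ F : Set E, (F = F₁ ∨ F = F₂) ∧
      (∀ y ∈ R, ∃ v ∈ F, dist y (t • A v) ≤ 1 / ((n : ℝ) + 1) * t) ∧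
      (∀ v ∈ F, ∃ y ∈ R, dist y (t • A v) ≤ 1 / ((n : ℝ) + 1) * t)) :
    ∃ A : E ≃ₗᵢ[ℝ] E, ∃ t : ℝ, 0 < t ∧ ∃ F : Set E, (F = F₁ ∨ F = F₂) ∧
      R = (fun v => t • A v) '' F := by
  -- matching at a finer tolerance is matching at a coarser one
  have hmono : ∀ (F : Set E) (N n : ℕ), N ≤ n → (∃ A : E ≃ₗᵢ[ℝ] E, ∃ t : ℝ, 0 < t ∧
      (∀ y ∈ R, ∃ v ∈ F, dist y (t • A v) ≤ 1 / ((n : ℝ) + 1) * t) ∧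
      (∀ v ∈ F, ∃ y ∈ R, dist y (t • A v) ≤ 1 / ((n : ℝ) + 1) * t)) →
      (∃ A : E ≃ₗᵢ[ℝ] E, ∃ t : ℝ, 0 < t ∧
      (∀ y ∈ R, ∃ v ∈ F, dist y (t • A v) ≤ 1 / ((N : ℝ) + 1) * t) ∧
      (∀ v ∈ F, ∃ y ∈ R, dist y (t • A v) ≤ 1 / ((N : ℝ) + 1) * t)) := by
    rintro F N n hNn ⟨A, t, ht, h1, h2⟩
    have hle : 1 / ((n : ℝ) + 1) * t ≤ 1 / ((N : ℝ) + 1) * t := by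
      refine mul_le_mul_of_nonneg_right ?_ ht.le
      exact one_div_le_one_div_of_le (by positivity) (by exact_mod_cast Nat.add_le_add_right hNn 1)
    exact ⟨A, t, ht, fun y hy => (h1 y hy).imp fun v hv => ⟨hv.1, hv.2.trans hle⟩,
      fun v hv => (h2 v hv).imp fun y hy => ⟨hy.1, hy.2.trans hle⟩⟩
  by_cases hinf : ∀ N : ℕ, ∃ n : ℕ, N ≤ n ∧ ∃ A : E ≃ₗᵢ[ℝ] E, ∃ t : ℝ, 0 < t ∧
      (∀ y ∈ R, ∃ v ∈ F₁, dist y (t • A v) ≤ 1 / ((n : ℝ) + 1) * t) ∧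
      (∀ v ∈ F₁, ∃ y ∈ R, dist y (t • A v) ≤ 1 / ((n : ℝ) + 1) * t)
  · -- `F₁` serves infinitely often
    obtain ⟨A, t, ht, hR'⟩ := exact_of_matched hR hF₁ hRne hm hc hC hRn hFn₁ fun N => by
      obtain ⟨n, hNn, h⟩ := hinf N
      exact hmono F₁ N n hNn h
    exact ⟨A, t, ht, F₁, Or.inl rfl, hR'⟩
  · -- otherwise `F₂` serves from some index on
    obtain ⟨N, hN⟩ := not_forall.1 hinf
    obtain ⟨A, t, ht, hR'⟩ := exact_of_matched hR hF₂ hRne hm hc hC hRn hFn₂ fun N' => by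
      obtain ⟨A, t, ht, F, hF, h1, h2⟩ := hmatch (max N N')
      rcases hF with hF | hF <;> rw [hF] at h1 h2
      · exact (hN ⟨_, le_max_left _ _, A, t, ht, h1, h2⟩).elim
      · exact hmono _ N' _ (le_max_right _ _) ⟨A, t, ht, h1, h2⟩
    exact ⟨A, t, ht, F₂, Or.inr rfl, hR'⟩

end Summit.AtomisticToContinuum.Crystallization.Theorems.PricedHcpWindowsSimilarStarNormalisation

end
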